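import Mathlib
import HarnessLib.Audit
import Summits.PneNP.PneNP.Theorems.PstarLocalUnionOutside

/-!
# P★ `h = 2` core bound — the COUPLED residues of O2: cotree-AND partners (E2) and the reduced blind-cross / cotree data (ROUND-25; planner p3 g23, memo §14.33–14.34; statements VERBATIM from `r25/SketchCoupled.lean`)

FRONTIER rung F-N3 (`stmt-PneNP-19007`), restricted model P★; nothing here bears on `P ≠ NP`.

After `TerminalFivePinned` / `card_le_five_of_pinned_outside` (prover-1 g17) the essential residue of O2 (`TerminalFiveEssential`) consists of terminal
pairs with a privates-touching monomial `x_p · x_v` of `w₁`, BOTH slots free on `Z = Sol_y(J₀) ∩ {w₂ = t₂}`, `p` a private of a chord `e_p ∈ J₀ ∖ F`, and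
`v` = (E1) a private of a chord (`PstarCross.CrossGate`; nodes `TerminalFiveCross1Blind/Read` in `PstarCross2`), (E2) an AND-input of a COTREE edge
`j₀ ∈ F` (`CotreeGate`, this file), (E3) an outside variable read by `w₂` (`MultiUnionFive`), or (DD) both members dirty.

This file types (E2) — `TerminalFiveCotree1` with its pinned case PROVED (`terminalFiveCotree1_of_free`) and the free case split `Blind` / `Read` exactly as
for the cross gate — and the two REDUCED DATA of memo §14.33 (B) / §14.34 obtained by fibring out the private pair `(x_p, x_{p′})` of the chord `e_p`
(which deletes `e_p` from the core and leaves a clean implication datum plus a monotone coupling with the XOR side `s_{e_p} = y_{e_p} + x_{a_p} + x_{b_p}`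
of the deleted chord):
* `CoupledFour` (from E2-blind): on `J₀ ∖ e_p`, `Z′ ⊆ {A = a} ∩ {ℓ_u ⟹ s_{e_p}}` minimally, `ℓ_u ∈ {x_u, ¬x_u}` the literal of the cotree AND-input ⟹ `#J₀ ≤ 5`;
* `CoupledThree` (from E1-blind, two distinct chords): on `J₀ ∖ {e_p, e_q}`, `Z′ ⊆ {A = a} ∩ {s_{e_p} ∨ s_{e_q}}` minimally ⟹ `#J₀ ≤ 5`.
The fibre lemmas `CoupledFour → TerminalFiveCotree1Blind` and `CoupledThree → TerminalFiveCross1Blind` (distinct chords; the same-chord cross gate reads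
the chord's own monomial `m_e ≡ s_e` on `Sol`, a separate easy case) are the provers' first items (pure `𝔽₂` casework on `S(0) = {00,01,10}`,
`S(1) = {11}`: a fibre with `s_p = 0` forces `λ_{p′} = 0` and `x_v ≡ λ_p` there; memo §14.33/14.34).
-/

set_option linter.dupNamespace false -- `Summit.PneNP.PneNP.…`: summit = sub-problem name (D-0017 single-conjunct layout)

open Finset Literature.Computability.Complexity
open Summit.PneNP.PneNP.Theorems.PstarTyped (Typed)
open Summit.PneNP.PneNP.Theorems.PstarSALevel (varSet bdry BoundaryExpanding SimpleOverlap)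
open Summit.PneNP.PneNP.Theorems.PstarGapOneAll (gval)
open Summit.PneNP.PneNP.Theorems.PstarCoreBound (XorClosed)
open Summit.PneNP.PneNP.Theorems.PstarChordRepair (IsChord)
open Summit.PneNP.PneNP.Theorems.PstarChordBridgeCotree (Peelable)
open Summit.PneNP.PneNP.Theorems.PstarChordBridgeTools (privs)
open Summit.PneNP.PneNP.Theorems.PstarCoreBoundTargets (Terminal TerminalFiveA)
open Summit.PneNP.PneNP.Theorems.PstarUnion (SatPair)
open Summit.PneNP.PneNP.Theorems.PstarMultiUnion (Outside)
open Summit.PneNP.PneNP.Theorems.PstarCross2 (PinnedTo)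
open Summit.PneNP.PneNP.Theorems.PstarLocalUnionOutside (card_le_five_of_pinned_outside)

namespace Summit.PneNP.PneNP.Theorems.PstarCoupled

variable {n m : ℕ}

/-! ## (E2) One cotree-partner gate -/

/-- `g` is a COTREE-PARTNER gate of the core `J₀` off `F`: one AND variable (slot `sp`) is a chord private, the other is an AND-input of a cotree edge. -/
def CotreeGate (I : LocalMap 4 n m) (J₀ F : Finset (Fin m)) (g : Fin m) (sp : Fin 4) : Prop :=
  (sp = 2 ∨ sp = 3) ∧ I.vars g sp ∈ privs I (J₀ \ F) ∧
    ∃ j₀ ∈ F, I.vars g (if sp = 2 then 3 else 2) = I.vars j₀ 2 ∨ I.vars g (if sp = 2 then 3 else 2) = I.vars j₀ 3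

/-- **TARGET (OPEN): `TerminalFiveA` with ONE cotree-partner gate** `g₀ ∈ w₁.2.1` and every other monomial of `w₁, w₂` avoiding the chord privates.
FRONTIER (census K18/K20: no configuration with `#J₀ ≥ 6` at `k ≤ 7` within menus). -/
@[conjecture] def TerminalFiveCotree1 : Prop :=
  ∀ (n m r : ℕ) (I : LocalMap 4 n m), I.IsPure xorAndPred → Typed I → SimpleOverlap I → BoundaryExpanding r I →
  ∀ (y : Fin m → Bool) (J₀ : Finset (Fin m)) (w₁ w₂ : Finset (Fin n) × Finset (Fin m) × Bool), Terminal I r y J₀ w₁ w₂ →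
    ∀ F ⊆ J₀, Peelable I F → (∀ F', F ⊆ F' → F' ⊆ J₀ → Peelable I F' → F' = F) → (∀ e ∈ J₀ \ F, IsChord I J₀ e) →
    ∀ g₀ ∈ w₁.2.1, ∀ sp : Fin 4, CotreeGate I J₀ F g₀ sp →
    (∀ g ∈ (w₁.2.1.erase g₀) ∪ w₂.2.1, ∀ v ∈ privs I (J₀ \ F), I.vars g 2 ≠ v ∧ I.vars g 3 ≠ v) →
    J₀.card ≤ 5

/-- **(E2, free, BLIND) (OPEN):** both slots of `g₀` free on `Z` and `w₂` does not read the privates of the chord of `p` linearly.  Reduces to `CoupledFour`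
by the fibre lemma of memo §14.34.  FRONTIER. -/
@[conjecture] def TerminalFiveCotree1Blind : Prop :=
  ∀ (n m r : ℕ) (I : LocalMap 4 n m), I.IsPure xorAndPred → Typed I → SimpleOverlap I → BoundaryExpanding r I →
  ∀ (y : Fin m → Bool) (J₀ : Finset (Fin m)) (w₁ w₂ : Finset (Fin n) × Finset (Fin m) × Bool), Terminal I r y J₀ w₁ w₂ →
    ∀ F ⊆ J₀, Peelable I F → (∀ F', F ⊆ F' → F' ⊆ J₀ → Peelable I F' → F' = F) → (∀ e ∈ J₀ \ F, IsChord I J₀ e) →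
    ∀ g₀ ∈ w₁.2.1, ∀ sp : Fin 4, CotreeGate I J₀ F g₀ sp →
    (∀ g ∈ (w₁.2.1.erase g₀) ∪ w₂.2.1, ∀ v ∈ privs I (J₀ \ F), I.vars g 2 ≠ v ∧ I.vars g 3 ≠ v) →
    (∀ c : Bool, SatPair I y J₀ (({I.vars g₀ 2} : Finset (Fin n)), (∅ : Finset (Fin m)), c) w₂) →
    (∀ c : Bool, SatPair I y J₀ (({I.vars g₀ 3} : Finset (Fin n)), (∅ : Finset (Fin m)), c) w₂) →
    (∀ e ∈ J₀ \ F, (I.vars e 2 = I.vars g₀ sp ∨ I.vars e 3 = I.vars g₀ sp) → I.vars e 2 ∉ w₂.1 ∧ I.vars e 3 ∉ w₂.1) →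
    J₀.card ≤ 5

/-- **(E2, free, READ) (OPEN):** `w₂` reads a private of the chord of `p` linearly — the chord-read world.  FRONTIER. -/
@[conjecture] def TerminalFiveCotree1Read : Prop :=
  ∀ (n m r : ℕ) (I : LocalMap 4 n m), I.IsPure xorAndPred → Typed I → SimpleOverlap I → BoundaryExpanding r I →
  ∀ (y : Fin m → Bool) (J₀ : Finset (Fin m)) (w₁ w₂ : Finset (Fin n) × Finset (Fin m) × Bool), Terminal I r y J₀ w₁ w₂ →
    ∀ F ⊆ J₀, Peelable I F → (∀ F', F ⊆ F' → F' ⊆ J₀ → Peelable I F' → F' = F) → (∀ e ∈ J₀ \ F, IsChord I J₀ e) →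
    ∀ g₀ ∈ w₁.2.1, ∀ sp : Fin 4, CotreeGate I J₀ F g₀ sp →
    (∀ g ∈ (w₁.2.1.erase g₀) ∪ w₂.2.1, ∀ v ∈ privs I (J₀ \ F), I.vars g 2 ≠ v ∧ I.vars g 3 ≠ v) →
    (∀ c : Bool, SatPair I y J₀ (({I.vars g₀ 2} : Finset (Fin n)), (∅ : Finset (Fin m)), c) w₂) →
    (∀ c : Bool, SatPair I y J₀ (({I.vars g₀ 3} : Finset (Fin n)), (∅ : Finset (Fin m)), c) w₂) →
    ∀ e ∈ J₀ \ F, (I.vars e 2 = I.vars g₀ sp ∨ I.vars e 3 = I.vars g₀ sp) → (I.vars e 2 ∈ w₂.1 ∨ I.vars e 3 ∈ w₂.1) →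
    J₀.card ≤ 5

/-- **The pinned case of (E2) is the union lemma** (`card_le_five_of_pinned_outside` with `M = {g₀}`, `Zs = ∅`); the free case splits Blind / Read. -/
theorem terminalFiveCotree1_of (hA : TerminalFiveCotree1Blind) (hB : TerminalFiveCotree1Read) : TerminalFiveCotree1 := by
  intro n m r I hI hT hS hB' y J₀ w₁ w₂ ht F hF hP hmax hch g₀ hg₀ sp hcg hun
  classical
  -- pinned slots first
  have pinned : ∀ s : Fin 4, (s = 2 ∨ s = 3) → ∀ c : Bool, PinnedTo I y J₀ w₂ (I.vars g₀ s) c → J₀.card ≤ 5 := by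
    intro s hs c hpin
    refine card_le_five_of_pinned_outside I hI hT hS hB' ht hF hP hmax hch (M := {g₀}) (singleton_subset_iff.2 hg₀) (sl := fun _ => s)
      (fun g hg => by simpa using hs) (c := fun _ => c) (fun g hg => by rw [mem_singleton.1 hg]; exact hpin) (Zs := ∅) (by simp) (by simp) ?_
    intro g hg v hv
    rcases mem_union.1 hg with hg | hg
    · have hg' := (mem_filter.1 hg).1
      exact hun g (mem_union.2 (Or.inl (by simpa [mem_sdiff, mem_erase, and_comm] using hg'))) v hv
    · exact hun g (mem_union.2 (Or.inr hg)) v hv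
  by_cases h2 : ∀ c : Bool, SatPair I y J₀ (({I.vars g₀ 2} : Finset (Fin n)), (∅ : Finset (Fin m)), c) w₂
  · by_cases h3 : ∀ c : Bool, SatPair I y J₀ (({I.vars g₀ 3} : Finset (Fin n)), (∅ : Finset (Fin m)), c) w₂
    · by_cases hbl : ∀ e ∈ J₀ \ F, (I.vars e 2 = I.vars g₀ sp ∨ I.vars e 3 = I.vars g₀ sp) → I.vars e 2 ∉ w₂.1 ∧ I.vars e 3 ∉ w₂.1
      · exact hA n m r I hI hT hS hB' y J₀ w₁ w₂ ht F hF hP hmax hch g₀ hg₀ sp hcg hun h2 h3 hbl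
      · push Not at hbl
        obtain ⟨e, he, hte, hr⟩ := hbl
        have hr' : I.vars e 2 ∈ w₂.1 ∨ I.vars e 3 ∈ w₂.1 := by
          by_cases h : I.vars e 2 ∈ w₂.1
          · exact Or.inl h
          · exact Or.inr (hr h)
        exact hB n m r I hI hT hS hB' y J₀ w₁ w₂ ht F hF hP hmax hch g₀ hg₀ sp hcg hun h2 h3 e he hte hr'
    · push Not at h3
      obtain ⟨c, hc⟩ := h3
      exact pinned 3 (Or.inr rfl) (!c) (by simpa [PinnedTo] using hc)
  · push Not at h2
    obtain ⟨c, hc⟩ := h2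
    exact pinned 2 (Or.inl rfl) (!c) (by simpa [PinnedTo] using hc)

/-- `TerminalFiveCotree1` is a sub-target of O2. -/
theorem terminalFiveCotree1_of_terminalFiveA (h : TerminalFiveA) : TerminalFiveCotree1 :=
  fun n m r I hI hT hS hB y J₀ w₁ w₂ ht F hF hP hmax hch _ _ _ _ _ => h n m r I hI hT hS hB y J₀ w₁ w₂ ht F hF hP hmax hch

/-! ## The reduced COUPLED data (memo §14.33 (B), §14.34) -/

/-- The XOR side of output `e` at `x`: `s_e(x) = y_e + x_{I.vars e 0} + x_{I.vars e 1}` — the value the AND-monomial of `e` must take if `e` is satisfied. -/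
def sform (I : LocalMap 4 n m) (y : Fin m → Bool) (e : Fin m) (x : Fin n → Bool) : Bool :=
  xor (y e) (xor (x (I.vars e 0)) (x (I.vars e 1)))

/-- **TARGET (OPEN): the COTREE-COUPLED datum bounds the core (`#J₀ ≤ 5`, i.e. `#(J₀ ∖ e) ≤ 4`).**  `J₀` a terminal-shaped core (XOR-closed, `#J₀ < r`,
admissible `F`, chords), `e ∈ J₀ ∖ F` the DELETED chord, `A`, `w₂` clean G-constraints not mentioning the privates of `e`, with radius slack one
(the fibred-out gate), `u` an AND-input of a cotree edge with literal polarity `pol`; on `J₀ ∖ e`: (i) `Sol ∩ {w₂ = t₂} ⊆ {A = a} ∩ {ℓ_u ⟹ s_e}`,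
(ii) minimally in every `f ∈ J₀ ∖ e`, (iii) `ℓ_u = 1` and `s_e = 0` are each met on `Sol ∩ {w₂ = t₂}`.  FRONTIER. -/
@[conjecture] def CoupledFour : Prop :=
  ∀ (n m r : ℕ) (I : LocalMap 4 n m), I.IsPure xorAndPred → Typed I → SimpleOverlap I → BoundaryExpanding r I →
  ∀ (y : Fin m → Bool) (J₀ F : Finset (Fin m)) (e : Fin m) (A w₂ : Finset (Fin n) × Finset (Fin m) × Bool) (u : Fin n) (pol : Bool),
    XorClosed I J₀ → J₀.card < r → Disjoint J₀ A.2.1 → Disjoint J₀ w₂.2.1 → (J₀ ∪ A.2.1 ∪ w₂.2.1).card < r →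
    F ⊆ J₀ → Peelable I F → (∀ F', F ⊆ F' → F' ⊆ J₀ → Peelable I F' → F' = F) → (∀ e' ∈ J₀ \ F, IsChord I J₀ e') →
    e ∈ J₀ \ F → (∃ j₀ ∈ F, u = I.vars j₀ 2 ∨ u = I.vars j₀ 3) →
    (∀ g ∈ A.2.1 ∪ w₂.2.1, ∀ v ∈ privs I (J₀ \ F), I.vars g 2 ≠ v ∧ I.vars g 3 ≠ v) →
    I.vars e 2 ∉ A.1 → I.vars e 3 ∉ A.1 → I.vars e 2 ∉ w₂.1 → I.vars e 3 ∉ w₂.1 →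
    -- (i) implication + coupling on `J₀ ∖ e`
    (∀ x, (∀ j ∈ J₀.erase e, I.eval x j = y j) → gval I w₂.1 w₂.2.1 x = w₂.2.2 →
      gval I A.1 A.2.1 x = A.2.2 ∧ (xor (x u) pol = true → sform I y e x = true)) →
    -- (ii) minimality
    (∀ f ∈ J₀.erase e, ∃ x, (∀ j ∈ (J₀.erase e).erase f, I.eval x j = y j) ∧ gval I w₂.1 w₂.2.1 x = w₂.2.2 ∧
      ¬ (gval I A.1 A.2.1 x = A.2.2 ∧ (xor (x u) pol = true → sform I y e x = true))) →
    -- (iii) the literal is on somewhere, the path-sum is off somewhere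
    (∃ x, (∀ j ∈ J₀.erase e, I.eval x j = y j) ∧ gval I w₂.1 w₂.2.1 x = w₂.2.2 ∧ xor (x u) pol = true) →
    (∃ x, (∀ j ∈ J₀.erase e, I.eval x j = y j) ∧ gval I w₂.1 w₂.2.1 x = w₂.2.2 ∧ sform I y e x = false) →
    J₀.card ≤ 5

/-- **TARGET (OPEN): the NOR-COUPLED datum of two deleted chords bounds the core (`#J₀ ≤ 5`, i.e. `#(J₀ ∖ {e_p, e_q}) ≤ 3`).**  As `CoupledFour` with two
distinct deleted chords and the coupling `s_{e_p} ∨ s_{e_q}` (no corner); (iii): each of `s_{e_p} = 0`, `s_{e_q} = 0` is met.  FRONTIER. -/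
@[conjecture] def CoupledThree : Prop :=
  ∀ (n m r : ℕ) (I : LocalMap 4 n m), I.IsPure xorAndPred → Typed I → SimpleOverlap I → BoundaryExpanding r I →
  ∀ (y : Fin m → Bool) (J₀ F : Finset (Fin m)) (e₁ e₂ : Fin m) (A w₂ : Finset (Fin n) × Finset (Fin m) × Bool),
    XorClosed I J₀ → J₀.card < r → Disjoint J₀ A.2.1 → Disjoint J₀ w₂.2.1 → (J₀ ∪ A.2.1 ∪ w₂.2.1).card < r →
    F ⊆ J₀ → Peelable I F → (∀ F', F ⊆ F' → F' ⊆ J₀ → Peelable I F' → F' = F) → (∀ e' ∈ J₀ \ F, IsChord I J₀ e') →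
    e₁ ∈ J₀ \ F → e₂ ∈ J₀ \ F → e₁ ≠ e₂ →
    (∀ g ∈ A.2.1 ∪ w₂.2.1, ∀ v ∈ privs I (J₀ \ F), I.vars g 2 ≠ v ∧ I.vars g 3 ≠ v) →
    (∀ e ∈ ({e₁, e₂} : Finset (Fin m)), I.vars e 2 ∉ A.1 ∧ I.vars e 3 ∉ A.1 ∧ I.vars e 2 ∉ w₂.1 ∧ I.vars e 3 ∉ w₂.1) →
    (∀ x, (∀ j ∈ (J₀.erase e₁).erase e₂, I.eval x j = y j) → gval I w₂.1 w₂.2.1 x = w₂.2.2 →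
      gval I A.1 A.2.1 x = A.2.2 ∧ (sform I y e₁ x = true ∨ sform I y e₂ x = true)) →
    (∀ f ∈ (J₀.erase e₁).erase e₂, ∃ x, (∀ j ∈ ((J₀.erase e₁).erase e₂).erase f, I.eval x j = y j) ∧ gval I w₂.1 w₂.2.1 x = w₂.2.2 ∧
      ¬ (gval I A.1 A.2.1 x = A.2.2 ∧ (sform I y e₁ x = true ∨ sform I y e₂ x = true))) →
    (∃ x, (∀ j ∈ (J₀.erase e₁).erase e₂, I.eval x j = y j) ∧ gval I w₂.1 w₂.2.1 x = w₂.2.2 ∧ sform I y e₁ x = false) →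
    (∃ x, (∀ j ∈ (J₀.erase e₁).erase e₂, I.eval x j = y j) ∧ gval I w₂.1 w₂.2.1 x = w₂.2.2 ∧ sform I y e₂ x = false) →
    J₀.card ≤ 5

end Summit.PneNP.PneNP.Theorems.PstarCoupled
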